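import Mathlib
import Summits.Ventures.PercRepro2.HCov
import Summits.Ventures.PercRepro2.GcSkelRules
import Summits.Ventures.PercRepro2.GcSeries
import Summits.Ventures.PercRepro2.GcTransport
import Summits.Ventures.PercRepro2.GcTransportMarks
import Summits.Ventures.PercRepro2.GcHatConn

/-!
# The hat: the two patterns, and the connectivity theorem (blind cell PercRepro2, typer-1 g56)

The two open patterns of a hat (`GcHatConn.lean`): `e₁, e₃` open (`a₁ – w`) and `e₂, e₃` open
(`a₂ – w`). In each, after the closed root edge is looped, `u` has exactly two non-loop edges and
the lane's series rule (`conn_series_iff`) contracts it into the root (resp. into `w`); the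
contracted graph agrees with the hat graph on every non-loop edge (`conn_contract_13`,
`conn_contract_32`), and the series configuration is the hat map (`hatMap_eq_series_13`,
`hatMap_eq_series_32`). With the no-pattern case of `GcHatConn.lean`:

* **`conn_hatGraph_iff`** — for `ω ∈ HatG` and `x, z ≠ u`: `x ↔ z` under `ω` in `G` iff `x ↔ z`
  under `hatMap ω` in `hatGraph`.

Standard axioms.
-/

namespace Summit.Ventures.PercRepro2

open CovForm Contract RECM WRed

namespace Hat

section Pattern

variable {V : Type*} {E : Type*} [DecidableEq V] [DecidableEq E] {ends : E → Sym2 V}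
  {u a₁ a₂ w : V} {e₁ e₂ e₃ : E}

omit [DecidableEq V] in
/-- `hatMap` at the pattern `a₁ – w` is the series map of `e₁, e₃`. -/
lemma hatMap_eq_series_13 (h : IsHatAt ends u a₁ a₂ w e₁ e₂ e₃) {ω : Config E} (h2 : ω e₂ = false) :
    hatMap e₁ e₂ e₃ ω = seriesMap e₁ e₃ ω := by
  funext g
  by_cases g3 : g = e₃
  · rw [g3, hatMap_e3, seriesMap, Function.update_of_ne h.e13.symm, Function.update_self]
  by_cases g2 : g = e₂
  · rw [g2, hatMap_e2 h, seriesMap, Function.update_of_ne h.e12.symm,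
      Function.update_of_ne h.e23, h2, Bool.false_and]
  by_cases g1 : g = e₁
  · rw [g1, hatMap_e1 h, seriesMap, Function.update_self]
  rw [hatMap_of_ne ω g1 g2 g3, seriesMap, Function.update_of_ne g1, Function.update_of_ne g3]

omit [DecidableEq V] in
/-- `hatMap` at the pattern `a₂ – w` is the series map of `e₃, e₂`. -/
lemma hatMap_eq_series_32 (h : IsHatAt ends u a₁ a₂ w e₁ e₂ e₃) {ω : Config E} (h1 : ω e₁ = false) :
    hatMap e₁ e₂ e₃ ω = seriesMap e₃ e₂ ω := by
  funext g
  by_cases g3 : g = e₃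
  · rw [g3, hatMap_e3, seriesMap, Function.update_self, h1, Bool.false_and]
  by_cases g2 : g = e₂
  · rw [g2, hatMap_e2 h, seriesMap, Function.update_of_ne h.e23, Function.update_self,
      Bool.and_comm]
  by_cases g1 : g = e₁
  · rw [g1, hatMap_e1 h, seriesMap, Function.update_of_ne h.e13, Function.update_of_ne h.e12, h1]
  rw [hatMap_of_ne ω g1 g2 g3, seriesMap, Function.update_of_ne g3, Function.update_of_ne g2]

omit [DecidableEq E] in
/-- Evaluating a contraction on an edge with known ends. -/
lemma contract_eval {ends' : E → Sym2 V} {r y : V} {g : E} {x₁ x₂ : V} (hg : ends' g = s(x₁, x₂)) :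
    contractRootEdge ends' r y g = s(contractMap {r, y} r x₁, contractMap {r, y} r x₂) := by
  rw [contractRootEdge, contractEnds_apply, hg, Sym2.map_mk]

omit [DecidableEq E] in
/-- A contraction maps loops to loops. -/
lemma contract_isDiag {ends' : E → Sym2 V} {r y : V} {g : E} (hg : (ends' g).IsDiag) :
    (contractRootEdge ends' r y g).IsDiag := by
  rw [contractRootEdge, contractEnds_apply]
  revert hg
  refine Sym2.inductionOn (ends' g) fun a b hab => ?_
  rw [Sym2.map_mk, Sym2.mk_isDiag_iff]
  rw [Sym2.mk_isDiag_iff] at hab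
  rw [hab]

/-- The contraction of `{a₁, u}` after looping `e₂` connects as the hat graph with `e₂` looped. -/
lemma conn_contract_13 (h : IsHatAt ends u a₁ a₂ w e₁ e₂ e₃) (ω : Config E) (x z : V) :
    Conn (contractRootEdge (Function.update ends e₂ s(u, u)) a₁ u) ω x z ↔
      Conn (Function.update (hatGraph ends a₁ a₂ w e₁ e₂ e₃) e₂ s(u, u)) ω x z := by
  have hC1 : contractRootEdge (Function.update ends e₂ s(u, u)) a₁ u e₁ = s(a₁, a₁) := by
    rw [contract_eval (by rw [Function.update_of_ne h.e12]; exact h.h1),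
      contractMap_of_ne h.ua1.symm, contractMap_of_mem (Finset.mem_insert_of_mem
        (Finset.mem_singleton_self u))]
  have hC2 : contractRootEdge (Function.update ends e₂ s(u, u)) a₁ u e₂ = s(a₁, a₁) := by
    rw [contract_eval (Function.update_self e₂ s(u, u) ends),
      contractMap_of_mem (Finset.mem_insert_of_mem (Finset.mem_singleton_self u))]
  have hC3 : contractRootEdge (Function.update ends e₂ s(u, u)) a₁ u e₃ = s(a₁, w) := by
    rw [contract_eval (by rw [Function.update_of_ne h.e23.symm]; exact h.h3),
      contractMap_of_ne h.uw.symm, contractMap_of_mem (Finset.mem_insert_of_mem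
        (Finset.mem_singleton_self u)), Sym2.eq_swap]
  have hR1 : Function.update (hatGraph ends a₁ a₂ w e₁ e₂ e₃) e₂ s(u, u) e₁ = s(a₁, a₁) := by
    rw [Function.update_of_ne h.e12, hatGraph_e1 h]
  have hR3 : Function.update (hatGraph ends a₁ a₂ w e₁ e₂ e₃) e₂ s(u, u) e₃ = s(a₁, w) := by
    rw [Function.update_of_ne h.e23.symm, hatGraph_e3]
  have hoff : ∀ g, g ≠ e₁ → g ≠ e₂ → g ≠ e₃ → u ∉ ends g →
      contractRootEdge (Function.update ends e₂ s(u, u)) a₁ u g = ends g := by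
    intro g g1 g2 g3 hu
    rw [contractRootEdge_of_notMem (by rw [Function.update_of_ne g2]; exact hu),
      Function.update_of_ne g2]
  refine conn_iff_of_agree_nonLoop ?_ ?_ ω x z
  · intro g hg
    by_cases g1 : g = e₁
    · exact absurd (by rw [g1, hC1]; simp) hg
    by_cases g2 : g = e₂
    · exact absurd (by rw [g2, hC2]; simp) hg
    by_cases g3 : g = e₃
    · rw [g3, hC3, hR3]
    by_cases hu : u ∈ ends g
    · exact absurd (contract_isDiag (by rw [Function.update_of_ne g2]; exact h.other g g1 g2 g3 hu))
        hg
    rw [hoff g g1 g2 g3 hu, Function.update_of_ne g2, hatGraph_of_ne g1 g2 g3]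
  · intro g hg
    by_cases g1 : g = e₁
    · exact absurd (by rw [g1, hR1]; simp) hg
    by_cases g2 : g = e₂
    · exact absurd (by rw [g2, Function.update_self]; simp) hg
    by_cases g3 : g = e₃
    · rw [g3, hC3, hR3]
    rw [Function.update_of_ne g2, hatGraph_of_ne g1 g2 g3] at hg ⊢
    have hu : u ∉ ends g := fun hu => hg (h.other g g1 g2 g3 hu)
    rw [hoff g g1 g2 g3 hu]

/-- The contraction of `{w, u}` after looping `e₁` connects as the hat graph with `e₃` looped. -/
lemma conn_contract_32 (h : IsHatAt ends u a₁ a₂ w e₁ e₂ e₃) (ω : Config E) (x z : V) :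
    Conn (contractRootEdge (Function.update ends e₁ s(u, u)) w u) ω x z ↔
      Conn (Function.update (hatGraph ends a₁ a₂ w e₁ e₂ e₃) e₃ s(u, u)) ω x z := by
  have hC1 : contractRootEdge (Function.update ends e₁ s(u, u)) w u e₁ = s(w, w) := by
    rw [contract_eval (Function.update_self e₁ s(u, u) ends),
      contractMap_of_mem (Finset.mem_insert_of_mem (Finset.mem_singleton_self u))]
  have hC2 : contractRootEdge (Function.update ends e₁ s(u, u)) w u e₂ = s(w, a₂) := by
    rw [contract_eval (by rw [Function.update_of_ne h.e12.symm]; exact h.h2),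
      contractMap_of_ne h.ua2.symm, contractMap_of_mem (Finset.mem_insert_of_mem
        (Finset.mem_singleton_self u)), Sym2.eq_swap]
  have hC3 : contractRootEdge (Function.update ends e₁ s(u, u)) w u e₃ = s(w, w) := by
    rw [contract_eval (by rw [Function.update_of_ne h.e13.symm]; exact h.h3),
      contractMap_of_ne h.uw.symm, contractMap_of_mem (Finset.mem_insert_of_mem
        (Finset.mem_singleton_self u))]
  have hR1 : Function.update (hatGraph ends a₁ a₂ w e₁ e₂ e₃) e₃ s(u, u) e₁ = s(a₁, a₁) := by
    rw [Function.update_of_ne h.e13, hatGraph_e1 h]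
  have hR2 : Function.update (hatGraph ends a₁ a₂ w e₁ e₂ e₃) e₃ s(u, u) e₂ = s(w, a₂) := by
    rw [Function.update_of_ne h.e23, hatGraph_e2 h]
  have hoff : ∀ g, g ≠ e₁ → g ≠ e₂ → g ≠ e₃ → u ∉ ends g →
      contractRootEdge (Function.update ends e₁ s(u, u)) w u g = ends g := by
    intro g g1 g2 g3 hu
    rw [contractRootEdge_of_notMem (by rw [Function.update_of_ne g1]; exact hu),
      Function.update_of_ne g1]
  refine conn_iff_of_agree_nonLoop ?_ ?_ ω x z
  · intro g hg
    by_cases g1 : g = e₁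
    · exact absurd (by rw [g1, hC1]; simp) hg
    by_cases g2 : g = e₂
    · rw [g2, hC2, hR2]
    by_cases g3 : g = e₃
    · exact absurd (by rw [g3, hC3]; simp) hg
    by_cases hu : u ∈ ends g
    · exact absurd (contract_isDiag (by rw [Function.update_of_ne g1]; exact h.other g g1 g2 g3 hu))
        hg
    rw [hoff g g1 g2 g3 hu, Function.update_of_ne g3, hatGraph_of_ne g1 g2 g3]
  · intro g hg
    by_cases g1 : g = e₁
    · exact absurd (by rw [g1, hR1]; simp) hg
    by_cases g2 : g = e₂
    · rw [g2, hC2, hR2]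
    by_cases g3 : g = e₃
    · exact absurd (by rw [g3, Function.update_self]; simp) hg
    rw [Function.update_of_ne g3, hatGraph_of_ne g1 g2 g3] at hg ⊢
    have hu : u ∉ ends g := fun hu => hg (h.other g g1 g2 g3 hu)
    rw [hoff g g1 g2 g3 hu]

/-- **The pattern `a₁ – w`**: `e₁, e₃` open, `e₂` closed. -/
lemma conn_hat_13 (h : IsHatAt ends u a₁ a₂ w e₁ e₂ e₃) {ω : Config E} (h1 : ω e₁ = true)
    (h3 : ω e₃ = true) (h2 : ω e₂ = false) {x z : V} (hx : x ≠ u) (hz : z ≠ u) :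
    Conn ends ω x z ↔ Conn (hatGraph ends a₁ a₂ w e₁ e₂ e₃) (hatMap e₁ e₂ e₃ ω) x z := by
  have _ := h1
  have _ := h3
  rw [hatMap_eq_series_13 h h2]
  have hc2 : seriesMap e₁ e₃ ω e₂ = false := by
    rw [seriesMap, Function.update_of_ne h.e12.symm, Function.update_of_ne h.e23, h2]
  rw [conn_loop_of_closed (g := e₂) hc2 u, conn_loop_of_closed (g := e₂) h2 u,
    ← conn_series_iff (e := e₁) (f := e₃) (a₁ := a₁) (y := u) (w := w)
      (by rw [Function.update_of_ne h.e12]; exact h.h1)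
      (by rw [Function.update_of_ne h.e23.symm, h.h3, Sym2.eq_swap]) h.e13 h.ua1.symm h.uw ?_ ω
      hx hz]
  · exact conn_contract_13 h _ x z
  · intro g hg1 hg3 hg
    by_cases g2 : g = e₂
    · rw [g2, Function.update_self]; simp
    rw [Function.update_of_ne g2] at hg ⊢
    exact h.other g hg1 g2 hg3 hg

/-- **The pattern `a₂ – w`**: `e₂, e₃` open, `e₁` closed. -/
lemma conn_hat_32 (h : IsHatAt ends u a₁ a₂ w e₁ e₂ e₃) {ω : Config E} (h2 : ω e₂ = true)
    (h3 : ω e₃ = true) (h1 : ω e₁ = false) {x z : V} (hx : x ≠ u) (hz : z ≠ u) :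
    Conn ends ω x z ↔ Conn (hatGraph ends a₁ a₂ w e₁ e₂ e₃) (hatMap e₁ e₂ e₃ ω) x z := by
  have _ := h2
  have _ := h3
  rw [hatMap_eq_series_32 h h1]
  have hc3 : seriesMap e₃ e₂ ω e₃ = false := by
    rw [seriesMap, Function.update_self]
  rw [conn_loop_of_closed (g := e₃) hc3 u, conn_loop_of_closed (g := e₁) h1 u,
    ← conn_series_iff (e := e₃) (f := e₂) (a₁ := w) (y := u) (w := a₂)
      (by rw [Function.update_of_ne h.e13.symm]; exact h.h3)
      (by rw [Function.update_of_ne h.e12.symm, h.h2, Sym2.eq_swap]) h.e23.symm h.uw.symm h.ua2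
      ?_ ω hx hz]
  · exact conn_contract_32 h _ x z
  · intro g hg3 hg2 hg
    by_cases g1 : g = e₁
    · rw [g1, Function.update_self]; simp
    rw [Function.update_of_ne g1] at hg ⊢
    exact h.other g g1 hg2 hg3 hg

/-- **THE HAT CONNECTIVITY**: on the admissible configurations, for `x, z ≠ u`, connectivity in
`G` is connectivity in the hat graph under the hat map. -/
theorem conn_hatGraph_iff (h : IsHatAt ends u a₁ a₂ w e₁ e₂ e₃) {ω : Config E} (hG : ω ∈ HatG e₁ e₂)
    {x z : V} (hx : x ≠ u) (hz : z ≠ u) :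
    Conn ends ω x z ↔ Conn (hatGraph ends a₁ a₂ w e₁ e₂ e₃) (hatMap e₁ e₂ e₃ ω) x z := by
  by_cases h13 : ω e₁ = true ∧ ω e₃ = true
  · have h2 : ω e₂ = false := by
      cases hh : ω e₂
      · rfl
      · exact absurd ⟨h13.1, hh⟩ hG
    exact conn_hat_13 h h13.1 h13.2 h2 hx hz
  by_cases h23 : ω e₂ = true ∧ ω e₃ = true
  · have h1 : ω e₁ = false := by
      cases hh : ω e₁
      · rfl
      · exact absurd ⟨hh, h23.1⟩ hG
    exact conn_hat_32 h h23.1 h23.2 h1 hx hz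
  exact conn_hat_none h h13 h23 hG hx hz

end Pattern

end Hat

end Summit.Ventures.PercRepro2
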